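import Summits.PneNP.PneNP.Theorems.ExpanderLinearGeneratorsColumnTwoRobust

/-!
# PneNP / ExpanderLinearGenerators — column weight two: new links and the minor from a linked
clique

Route `PneNP/ExpanderLinearGenerators`, support for crux stmt-PneNP-11443. Two ingredients of the
Krivelevich–Sudakov iteration (`…ColumnTwoMinor`):

* `exists_new_link` — after deleting `R ⊆ U` (`(12K+3)|R| + 3 ≤ r`) and pruning (`X`, `D`), any
  two rows `y₁, y₂ ∈ D` are joined inside `U \\ R` by a connected set of `≤ 2(s+1) + 2(t+1)` rows
  containing both (fat balls in `D` + the linking lemma + geodesics);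
* `isConn_union_links`, `minor_of_links` — if a family `G` of pairwise disjoint connected branch
  sets is pairwise linked by connected, pairwise disjoint link sets outside the branch sets, each
  adjacent to both its ends, then `B ↦ B ∪ ⋃_{B'} P B B'` is a `K_G` minor model: connected,
  pairwise disjoint, pairwise adjacent.

[cite: KrivelevichSudakov2009Minors, proof of Prop. 4.3]
-/

namespace Summit.PneNP.PneNP.Theorems.ColumnTwo

open Finset Literature.Computability.MetaComplexity

variable {ι : Type*} [DecidableEq ι] {S : ι → Finset ℕ}

/-- **A new link through the pruned set.** [cite: KrivelevichSudakov2009Minors, §5] -/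
theorem exists_new_link {U R X : Finset ι} {r K s t : ℕ}
    (hX2 : ∀ W ⊆ U, 2 * W.card ≤ U.card → 3 * W.card ≤ 4 * K * (nbr S U W).card)
    (hRU : R ⊆ U) (hvol : (12 * K + 3) * R.card + 3 ≤ r)
    (hXR : 619 * X.card ≤ 500 * R.card) (hX3 : 3 * X.card ≤ r)
    (hD : ∀ Y ⊆ (U \ R) \ X, 3 * (X.card + Y.card) ≤ r → Y.card ≤ 4 * (nbr S ((U \ R) \ X) Y).card)
    (hs : (2 * K) ^ s * U.card < (2 * K + 1) ^ s) (ht : 4 ^ t * r < 3 * 5 ^ t)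
    {y₁ y₂ : ι} (hy₁ : y₁ ∈ (U \ R) \ X) (hy₂ : y₂ ∈ (U \ R) \ X) :
    ∃ Pn ⊆ U \ R, IsConn S Pn ∧ y₁ ∈ Pn ∧ y₂ ∈ Pn ∧ Pn.card ≤ 2 * (s + 1) + 2 * (t + 1) := by
  set D := (U \ R) \ X with hDdef
  have hDsub : D ⊆ U \ R := Finset.sdiff_subset
  -- fat balls around `y₁`, `y₂` in `D`
  have fat : ∀ y ∈ D, 4 * K * R.card ≤ (ball S D {y} t).card ∧ ball S D {y} t ⊆ U \ R ∧
      IsConn S (ball S D {y} t) ∧ (ball S D {y} t).Nonempty := by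
    intro y hy
    have h1 := fat_ball hD hX3 hy ht
    refine ⟨?_, (ball_subset (Finset.singleton_subset_iff.2 hy) t).trans hDsub,
      isConn_ball (isConn_singleton y) t, ⟨y, subset_ball D {y} t (Finset.mem_singleton_self y)⟩⟩
    have h2 : X.card ≤ R.card := by omega
    have h3 : 3 * (4 * K * R.card) + 3 ≤ r - 3 * X.card := by
      have : (12 * K + 3) * R.card = 3 * (4 * K * R.card) + 3 * R.card := by ring
      omega
    have h4 := Nat.div_mul_le_self (r - 3 * X.card) 3
    have h5 : 4 * K * R.card ≤ (r - 3 * X.card) / 3 := by omega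
    omega
  obtain ⟨hf₁, hb₁, hc₁, hn₁⟩ := fat y₁ hy₁
  obtain ⟨hf₂, hb₂, hc₂, hn₂⟩ := fat y₂ hy₂
  obtain ⟨P₀, hP₀, hP₀c, hm₁, hm₂, hP₀card⟩ := exists_link hX2 hRU hb₁ hb₂ hn₁ hn₂ hf₁ hf₂ hs
  obtain ⟨w₁, hw₁⟩ := hm₁
  obtain ⟨w₂, hw₂⟩ := hm₂
  rw [Finset.mem_inter] at hw₁ hw₂
  obtain ⟨Q₁, hQ₁, hQ₁c, hwQ₁, hQy₁, hQ₁card⟩ := exists_geodesic hw₁.2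
  obtain ⟨Q₂, hQ₂, hQ₂c, hwQ₂, hQy₂, hQ₂card⟩ := exists_geodesic hw₂.2
  have hyQ₁ : y₁ ∈ Q₁ := by
    obtain ⟨z, hz⟩ := hQy₁
    rw [Finset.mem_inter, Finset.mem_singleton] at hz
    exact hz.2 ▸ hz.1
  have hyQ₂ : y₂ ∈ Q₂ := by
    obtain ⟨z, hz⟩ := hQy₂
    rw [Finset.mem_inter, Finset.mem_singleton] at hz
    exact hz.2 ▸ hz.1
  refine ⟨P₀ ∪ Q₁ ∪ Q₂, ?_, ?_, ?_, ?_, ?_⟩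
  · exact Finset.union_subset (Finset.union_subset hP₀ (hQ₁.trans hb₁)) (hQ₂.trans hb₂)
  · refine (hP₀c.union hQ₁c (Or.inr ⟨w₁, Finset.mem_inter.2 ⟨hw₁.1, hwQ₁⟩⟩)).union hQ₂c
      (Or.inr ⟨w₂, Finset.mem_inter.2 ⟨Finset.mem_union_left _ hw₂.1, hwQ₂⟩⟩)
  · exact Finset.mem_union_left _ (Finset.mem_union_right _ hyQ₁)
  · exact Finset.mem_union_right _ hyQ₂
  · exact (Finset.card_union_le _ _).trans (Nat.add_le_add
      ((Finset.card_union_le _ _).trans (Nat.add_le_add hP₀card hQ₁card)) hQ₂card) |>.trans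
      (by omega)

/-- Connectivity of a branch set with its links attached. [folklore] -/
theorem isConn_union_links {B : Finset ι} (hB : IsConn S B) (F : Finset (Finset ι))
    (P : Finset ι → Finset ι)
    (hP : ∀ B' ∈ F, (P B').Nonempty → IsConn S (P B') ∧ ∃ x ∈ P B', ∃ b ∈ B, (S b ∩ S x).Nonempty) :
    IsConn S (B ∪ F.biUnion P) := by
  classical
  induction F using Finset.induction_on with
  | empty => simpa using hB
  | insert B'' F hB'' ih =>
    have ih' := ih fun B' hB' => hP B' (Finset.mem_insert_of_mem hB')
    rw [Finset.biUnion_insert, Finset.union_comm (P B''), ← Finset.union_assoc]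
    rcases (P B'').eq_empty_or_nonempty with h | h
    · rw [h, Finset.union_empty]; exact ih'
    · obtain ⟨hc, x, hx, b, hb, hbx⟩ := hP B'' (Finset.mem_insert_self B'' F) h
      exact ih'.union hc (Or.inl ⟨b, Finset.mem_union_left _ hb, x, hx, hbx⟩)

/-- **The minor from a pairwise linked family.** Let `G ⊆ F` be families of pairwise disjoint
connected row sets of `U`, and `P B B'` (`B, B'` arbitrary) link sets inside `U` avoiding `⋃ F`,
pairwise disjoint for distinct ordered pairs, each nonempty one connected and adjacent to `B` and to
`B'`. If every two distinct members of `G` are linked (in one of the two orders), then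
`T B = B ∪ ⋃_{B' ∈ F} P B B'` is a `K_G` minor model. [cite: KrivelevichSudakov2009Minors, §5] -/
theorem minor_of_links {U : Finset ι} {F G : Finset (Finset ι)} (hGF : G ⊆ F)
    (hFm : ∀ B ∈ F, B ⊆ U ∧ IsConn S B) (hFd : ∀ B ∈ F, ∀ B' ∈ F, B ≠ B' → Disjoint B B')
    (P : Finset ι → Finset ι → Finset ι) (hP1 : ∀ B B', P B B' ⊆ U \ F.biUnion id)
    (hP2 : ∀ B B', (P B B').Nonempty → IsConn S (P B B') ∧
      (∃ x ∈ P B B', ∃ b ∈ B, (S b ∩ S x).Nonempty) ∧ (∃ x ∈ P B B', ∃ b ∈ B', (S b ∩ S x).Nonempty))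
    (hP3 : ∀ B₁ B₁' B₂ B₂' : Finset ι, (B₁, B₁') ≠ (B₂, B₂') → Disjoint (P B₁ B₁') (P B₂ B₂'))
    (hlinks : ∀ B ∈ G, ∀ B' ∈ G, B ≠ B' → (P B B').Nonempty ∨ (P B' B).Nonempty) :
    ∃ T : Finset ι → Finset ι, (∀ B ∈ G, B ⊆ T B ∧ T B ⊆ U ∧ IsConn S (T B)) ∧
      ∀ B ∈ G, ∀ B' ∈ G, B ≠ B' → Disjoint (T B) (T B') ∧
        ∃ a ∈ T B, ∃ b ∈ T B', (S a ∩ S b).Nonempty := by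
  classical
  refine ⟨fun B => B ∪ F.biUnion (P B), fun B hB => ⟨Finset.subset_union_left, ?_, ?_⟩, ?_⟩
  · exact Finset.union_subset (hFm B (hGF hB)).1 (Finset.biUnion_subset.2 fun B' _ =>
      (hP1 B B').trans Finset.sdiff_subset)
  · exact isConn_union_links (hFm B (hGF hB)).2 F (P B) fun B' _ h => ⟨(hP2 B B' h).1, (hP2 B B' h).2.1⟩
  intro B hB B' hB' hne
  have hBF : B ⊆ F.biUnion id := Finset.subset_biUnion_of_mem id (hGF hB)
  have hB'F : B' ⊆ F.biUnion id := Finset.subset_biUnion_of_mem id (hGF hB')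
  constructor
  · rw [Finset.disjoint_left]
    intro j hj hj'
    rcases Finset.mem_union.1 hj with hjB | hjP <;> rcases Finset.mem_union.1 hj' with hjB' | hjP'
    · exact Finset.disjoint_left.1 (hFd B (hGF hB) B' (hGF hB') hne) hjB hjB'
    · obtain ⟨B'', -, hj''⟩ := Finset.mem_biUnion.1 hjP'
      exact (Finset.mem_sdiff.1 (hP1 B' B'' hj'')).2 (hBF hjB)
    · obtain ⟨B'', -, hj''⟩ := Finset.mem_biUnion.1 hjP
      exact (Finset.mem_sdiff.1 (hP1 B B'' hj'')).2 (hB'F hjB')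
    · obtain ⟨B₁, -, hj₁⟩ := Finset.mem_biUnion.1 hjP
      obtain ⟨B₂, -, hj₂⟩ := Finset.mem_biUnion.1 hjP'
      exact Finset.disjoint_left.1 (hP3 B B₁ B' B₂ fun h => hne (Prod.mk.inj h).1) hj₁ hj₂
  · rcases hlinks B hB B' hB' hne with h | h
    · obtain ⟨-, -, x, hx, b, hb, hbx⟩ := hP2 B B' h
      exact ⟨x, Finset.mem_union_right _ (Finset.mem_biUnion.2 ⟨B', hGF hB', hx⟩), b,
        Finset.mem_union_left _ hb, adj_symm hbx⟩
    · obtain ⟨-, -, x, hx, b, hb, hbx⟩ := hP2 B' B h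
      exact ⟨b, Finset.mem_union_left _ hb, x,
        Finset.mem_union_right _ (Finset.mem_biUnion.2 ⟨B, hGF hB, hx⟩), hbx⟩

end Summit.PneNP.PneNP.Theorems.ColumnTwo

/-!
# PneNP / ExpanderLinearGenerators — column weight two: a large clique minor in the core
(Krivelevich–Sudakov iteration)

Route `PneNP/ExpanderLinearGenerators`, support for crux stmt-PneNP-11443. The Krivelevich–Sudakov
construction of complete minors in expanding graphs, run inside the dense core `U` with its
two expansion properties (`hX1`: small sets expand by `1.488`; `hX2`: halves expand by `3/(4K)`),
phrased as ONE extremal choice: among all valid link configurations (pairwise disjoint connected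
link sets of `≤ L` rows outside the `p` branch sets, each adjacent to both its ends) take one with
the most links; by the union lemma at least `p/6` branch sets are GOOD (have a neighbour in the
pruned set), and if two good ones were unlinked, `exists_new_link` would add a link. Hence:

* `exists_clique_minor` — a sub-family `G` of the branch sets with `6|G| ≥ p` and a `K_G` minor
  model `T` (connected, pairwise disjoint, pairwise adjacent branch sets `T B ⊇ B`).

References: M. Krivelevich, B. Sudakov, *Minors in expanding graphs*, GAFA 19 (2009) 294–331
(arXiv:0707.0133), Proposition 4.3 and its proof in §5.
-/

namespace Summit.PneNP.PneNP.Theorems.ColumnTwo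

open Finset Literature.Computability.MetaComplexity

variable {ι : Type*} [DecidableEq ι] {S : ι → Finset ℕ}

/-- **A clique minor of order `≥ p/6` in the core** (Krivelevich–Sudakov). Let `U` be a core with
the expansion properties `hX1` (scale `r`) and `hX2` (rate `3/(4K)`), radii `s, t` with
`(2K)^s |U| < (2K+1)^s` and `4^t r < 3·5^t`, `L = 2(s+1) + 2(t+1)`, and `F` a family of `p`
pairwise disjoint connected `q`-subsets of `U` (`q ≥ 1`) with `(12K+3)(pq + p²L) + 3 ≤ r` and
`8pL ≤ q`. Then some `G ⊆ F` with `6|G| ≥ p` carries a `K_G` minor model: sets `T B ⊇ B` inside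
`U`, connected, pairwise disjoint and pairwise adjacent.
[cite: KrivelevichSudakov2009Minors, Prop. 4.3] -/
theorem exists_clique_minor {U : Finset ι} {r K s t p q : ℕ}
    (hX1 : ∀ W ⊆ U, 3 * W.card ≤ r → 186 * W.card ≤ 125 * (nbr S U W).card)
    (hX2 : ∀ W ⊆ U, 2 * W.card ≤ U.card → 3 * W.card ≤ 4 * K * (nbr S U W).card)
    (hs : (2 * K) ^ s * U.card < (2 * K + 1) ^ s) (ht : 4 ^ t * r < 3 * 5 ^ t)
    {F : Finset (Finset ι)} (hFc : F.card = p) (hFm : ∀ B ∈ F, B ⊆ U ∧ IsConn S B ∧ B.card = q)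
    (hFd : ∀ B ∈ F, ∀ B' ∈ F, B ≠ B' → Disjoint B B') (hq : 1 ≤ q)
    (hvol : (12 * K + 3) * (p * q + p * p * (2 * (s + 1) + 2 * (t + 1))) + 3 ≤ r)
    (h8 : 8 * p * (2 * (s + 1) + 2 * (t + 1)) ≤ q) :
    ∃ G ⊆ F, p ≤ 6 * G.card ∧ ∃ T : Finset ι → Finset ι,
      (∀ B ∈ G, B ⊆ T B ∧ T B ⊆ U ∧ IsConn S (T B)) ∧
      ∀ B ∈ G, ∀ B' ∈ G, B ≠ B' → Disjoint (T B) (T B') ∧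
        ∃ a ∈ T B, ∃ b ∈ T B', (S a ∩ S b).Nonempty := by
  classical
  set L := 2 * (s + 1) + 2 * (t + 1) with hL
  suffices key : ∀ (n : ℕ) (P : Finset ι → Finset ι → Finset ι),
      (∀ B B', P B B' ⊆ U \ F.biUnion id) →
      (∀ B B', (P B B').Nonempty → B ∈ F ∧ B' ∈ F ∧ B ≠ B' ∧ IsConn S (P B B') ∧
        (P B B').card ≤ L ∧ (∃ x ∈ P B B', ∃ b ∈ B, (S b ∩ S x).Nonempty) ∧
        (∃ x ∈ P B B', ∃ b ∈ B', (S b ∩ S x).Nonempty)) →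
      (∀ B₁ B₁' B₂ B₂' : Finset ι, (B₁, B₁') ≠ (B₂, B₂') → Disjoint (P B₁ B₁') (P B₂ B₂')) →
      (F ×ˢ F).card - ((F ×ˢ F).filter fun BB => (P BB.1 BB.2).Nonempty).card = n →
      ∃ G ⊆ F, p ≤ 6 * G.card ∧ ∃ T : Finset ι → Finset ι,
        (∀ B ∈ G, B ⊆ T B ∧ T B ⊆ U ∧ IsConn S (T B)) ∧
        ∀ B ∈ G, ∀ B' ∈ G, B ≠ B' → Disjoint (T B) (T B') ∧
          ∃ a ∈ T B, ∃ b ∈ T B', (S a ∩ S b).Nonempty by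
    exact key _ (fun _ _ => ∅) (by simp) (by simp) (by simp) rfl
  intro n
  induction n using Nat.strong_induction_on with
  | _ n ih =>
  intro P hV1 hV2 hV3 hn
  set links := (F ×ˢ F).filter fun BB => (P BB.1 BB.2).Nonempty with hlinksdef
  -- the deleted set `R`: branch sets and links
  set R := F.biUnion id ∪ links.biUnion fun BB => P BB.1 BB.2 with hRdef
  have hFR : F.biUnion id ⊆ R := Finset.subset_union_left
  have hPR : ∀ B B', P B B' ⊆ R := by
    intro B B'
    rcases (P B B').eq_empty_or_nonempty with h | h
    · rw [h]; exact Finset.empty_subset _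
    · obtain ⟨hB, hB', -⟩ := hV2 B B' h
      have hmem : (B, B') ∈ links := Finset.mem_filter.2 ⟨Finset.mem_product.2 ⟨hB, hB'⟩, h⟩
      exact (Finset.subset_biUnion_of_mem (fun BB => P BB.1 BB.2) hmem).trans
        Finset.subset_union_right
  have hRU : R ⊆ U := Finset.union_subset (Finset.biUnion_subset.2 fun B hB => (hFm B hB).1)
    (Finset.biUnion_subset.2 fun BB _ => (hV1 BB.1 BB.2).trans Finset.sdiff_subset)
  have hlinks_le : links.card ≤ p * p :=
    (Finset.card_filter_le _ _).trans (by rw [Finset.card_product, hFc])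
  have hRcard : R.card ≤ p * q + p * p * L := by
    have h1 : (F.biUnion id).card ≤ p * q :=
      calc (F.biUnion id).card ≤ ∑ B ∈ F, (id B).card := Finset.card_biUnion_le
        _ = ∑ B ∈ F, q := Finset.sum_congr rfl fun B hB => (hFm B hB).2.2
        _ = p * q := by rw [Finset.sum_const, smul_eq_mul, hFc]
    have h2 : (links.biUnion fun BB => P BB.1 BB.2).card ≤ p * p * L :=
      calc (links.biUnion fun BB => P BB.1 BB.2).card ≤ ∑ BB ∈ links, (P BB.1 BB.2).card :=
            Finset.card_biUnion_le
        _ ≤ ∑ BB ∈ links, L := Finset.sum_le_sum fun BB hBB =>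
            (hV2 BB.1 BB.2 (Finset.mem_filter.1 hBB).2).2.2.2.2.1
        _ = links.card * L := by rw [Finset.sum_const, smul_eq_mul]
        _ ≤ p * p * L := Nat.mul_le_mul_right _ hlinks_le
    exact (Finset.card_union_le _ _).trans (Nat.add_le_add h1 h2)
  have hvolR : (12 * K + 3) * R.card + 3 ≤ r :=
    le_trans (by have := Nat.mul_le_mul_left (12 * K + 3) hRcard; omega) hvol
  have h3R : 3 * R.card ≤ r := by
    have : 3 * R.card ≤ (12 * K + 3) * R.card := Nat.mul_le_mul_right _ (by omega)
    omega
  -- pruning, good and bad branch sets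
  obtain ⟨X, -, hXR, hX3, hD⟩ := exists_pruning hX1 hRU
  set D := (U \ R) \ X with hDdef
  set Bad := F.filter fun B => ∀ y ∈ nbr S U B, y ∉ D with hBad
  set Gd := F.filter fun B => ¬ ∀ y ∈ nbr S U B, y ∉ D with hGdDef
  have hcount : Bad.card + Gd.card = F.card := Finset.card_filter_add_card_filter_not _
  have hZ := card_biUnion_bad_le hX1 hRU h3R Bad id
    (fun B hB => (Finset.subset_biUnion_of_mem id (Finset.mem_filter.1 hB).1).trans hFR)
    (fun B hB y hy => (Finset.mem_filter.1 hB).2 y hy)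
  have hZeq : (Bad.biUnion id).card = Bad.card * q := by
    rw [Finset.card_biUnion (t := id) fun B hB B' hB' hne => hFd B (Finset.mem_filter.1 hB).1 B'
      (Finset.mem_filter.1 hB').1 hne]
    have : ∑ u ∈ Bad, (id u).card = ∑ u ∈ Bad, q :=
      Finset.sum_congr rfl fun B hB => (hFm B (Finset.mem_filter.1 hB).1).2.2
    rw [this, Finset.sum_const, smul_eq_mul]
  have hGd : p ≤ 6 * Gd.card := by
    have h1 : p * (8 * p * L) ≤ p * q := Nat.mul_le_mul_left p h8
    have h2 : 6 * (Bad.card * q) ≤ 5 * p * q := by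
      rw [← hZeq]; nlinarith
    have h3 : (6 * Bad.card) * q ≤ (5 * p) * q := by
      calc (6 * Bad.card) * q = 6 * (Bad.card * q) := by ring
        _ ≤ 5 * p * q := h2
        _ = _ := by ring
    have h4 := Nat.le_of_mul_le_mul_right h3 (by omega)
    omega
  by_cases hcase : ∀ B ∈ Gd, ∀ B' ∈ Gd, B ≠ B' → (P B B').Nonempty ∨ (P B' B).Nonempty
  · obtain ⟨T, hT1, hT2⟩ := minor_of_links (G := Gd) (Finset.filter_subset _ _)
      (fun B hB => ⟨(hFm B hB).1, (hFm B hB).2.1⟩) hFd P hV1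
      (fun B B' h => ⟨(hV2 B B' h).2.2.2.1, (hV2 B B' h).2.2.2.2.2⟩) hV3 hcase
    exact ⟨Gd, Finset.filter_subset _ _, hGd, T, hT1, hT2⟩
  -- otherwise add a link between two unlinked good sets
  push Not at hcase
  obtain ⟨B₁, hB₁, B₂, hB₂, hne, hP12, hP21⟩ := hcase
  have good : ∀ B ∈ Gd, ∃ y ∈ nbr S U B, y ∈ D := fun B hB => by
    simpa using (Finset.mem_filter.1 hB).2
  obtain ⟨y₁, hy₁n, hy₁D⟩ := good B₁ hB₁
  obtain ⟨y₂, hy₂n, hy₂D⟩ := good B₂ hB₂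
  obtain ⟨Pn, hPn, hPnc, hy₁P, hy₂P, hPncard⟩ :=
    exists_new_link hX2 hRU hvolR hXR hX3 hD hs ht hy₁D hy₂D
  have hB₁F : B₁ ∈ F := (Finset.mem_filter.1 hB₁).1
  have hB₂F : B₂ ∈ F := (Finset.mem_filter.1 hB₂).1
  set P' : Finset ι → Finset ι → Finset ι := fun B B' => if B = B₁ ∧ B' = B₂ then Pn else P B B'
    with hP'def
  have hP'eq : ∀ B B', ¬ (B = B₁ ∧ B' = B₂) → P' B B' = P B B' := fun B B' h => if_neg h
  have hP'12 : P' B₁ B₂ = Pn := if_pos ⟨rfl, rfl⟩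
  have hPnR : Disjoint Pn R := Finset.disjoint_left.2 fun j hj hjR => (Finset.mem_sdiff.1 (hPn hj)).2 hjR
  -- validity of `P'`
  have hV1' : ∀ B B', P' B B' ⊆ U \ F.biUnion id := by
    intro B B'
    by_cases h : B = B₁ ∧ B' = B₂
    · rw [h.1, h.2, hP'12]
      exact hPn.trans (Finset.sdiff_subset_sdiff (Finset.Subset.refl _) hFR)
    · rw [hP'eq B B' h]; exact hV1 B B'
  have hV2' : ∀ B B', (P' B B').Nonempty → B ∈ F ∧ B' ∈ F ∧ B ≠ B' ∧ IsConn S (P' B B') ∧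
      (P' B B').card ≤ L ∧ (∃ x ∈ P' B B', ∃ b ∈ B, (S b ∩ S x).Nonempty) ∧
      (∃ x ∈ P' B B', ∃ b ∈ B', (S b ∩ S x).Nonempty) := by
    intro B B' hne'
    by_cases h : B = B₁ ∧ B' = B₂
    · obtain ⟨rfl, rfl⟩ := h
      rw [hP'12]
      obtain ⟨-, -, b₁, hb₁, hb₁y⟩ := mem_nbr.1 hy₁n
      obtain ⟨-, -, b₂, hb₂, hb₂y⟩ := mem_nbr.1 hy₂n
      exact ⟨hB₁F, hB₂F, hne, hPnc, by rw [hL]; exact hPncard, ⟨y₁, hy₁P, b₁, hb₁, hb₁y⟩,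
        ⟨y₂, hy₂P, b₂, hb₂, hb₂y⟩⟩
    · rw [hP'eq B B' h] at hne' ⊢
      exact hV2 B B' hne'
  have hV3' : ∀ B₃ B₃' B₄ B₄' : Finset ι, (B₃, B₃') ≠ (B₄, B₄') →
      Disjoint (P' B₃ B₃') (P' B₄ B₄') := by
    intro B₃ B₃' B₄ B₄' hne'
    by_cases h₃ : B₃ = B₁ ∧ B₃' = B₂ <;> by_cases h₄ : B₄ = B₁ ∧ B₄' = B₂
    · exact absurd (by rw [h₃.1, h₃.2, h₄.1, h₄.2]) hne'
    · rw [h₃.1, h₃.2, hP'12, hP'eq _ _ h₄]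
      exact hPnR.mono_right (hPR _ _)
    · rw [h₄.1, h₄.2, hP'12, hP'eq _ _ h₃]
      exact (hPnR.mono_right (hPR _ _)).symm
    · rw [hP'eq _ _ h₃, hP'eq _ _ h₄]
      exact hV3 _ _ _ _ hne'
  -- the number of links went up by one
  have hnotin : (B₁, B₂) ∉ links := fun h => by
    have := (Finset.mem_filter.1 h).2
    rw [hP12] at this
    exact Finset.not_nonempty_empty this
  have hlinks' : ((F ×ˢ F).filter fun BB => (P' BB.1 BB.2).Nonempty) = insert (B₁, B₂) links := by
    ext ⟨B, B'⟩
    simp only [Finset.mem_filter, Finset.mem_insert, hlinksdef, Prod.mk.injEq]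
    constructor
    · rintro ⟨hBB, hne'⟩
      by_cases h : B = B₁ ∧ B' = B₂
      · exact Or.inl h
      · exact Or.inr ⟨hBB, by rwa [hP'eq B B' h] at hne'⟩
    · rintro (⟨rfl, rfl⟩ | ⟨hBB, hne'⟩)
      · exact ⟨Finset.mem_product.2 ⟨hB₁F, hB₂F⟩, by rw [hP'12]; exact ⟨y₁, hy₁P⟩⟩
      · refine ⟨hBB, ?_⟩
        by_cases h : B = B₁ ∧ B' = B₂
        · rw [h.1, h.2, hP'12]; exact ⟨y₁, hy₁P⟩
        · rwa [hP'eq B B' h]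
  have hcard' : ((F ×ˢ F).filter fun BB => (P' BB.1 BB.2).Nonempty).card = links.card + 1 := by
    rw [hlinks', Finset.card_insert_of_notMem hnotin]
  have hle' : links.card + 1 ≤ (F ×ˢ F).card := by
    rw [← hcard']; exact Finset.card_filter_le _ _
  exact ih ((F ×ˢ F).card - (links.card + 1)) (by omega) P' hV1' hV2' hV3' (by rw [hcard'])

end Summit.PneNP.PneNP.Theorems.ColumnTwo
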